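import Mathlib
import Summits.ValiantsHypothesis.ValiantsHypothesis.Theorems.BarrierLeverPartitionMinorsHitByVPHiddenStatesFullJoinStep

/-!
# Route BarrierLever — item `PartitionMinorsHitByVP` (stmt-ValiantsHypothesis-19717), line `hidden_states`:
# THE UNEQUAL-LINK CUT for conjecture FJ — one new state reduces `(𝒰, 𝒲)` to a two-storey matrix of the old sum

Helper file (`--supports stmt-ValiantsHypothesis-19717`; cell valiant-natproofs, rung V4, 𝒟-side door (c), line
`Cruxes/PartitionMinorsHitByVP/Lines/hidden_states.lean` v8; prover seat val-np-p3 gen 16). Definition-free. Closes NO item.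

THE POINT (memo val-np-p3 g16 «full join» §14(b)). The equal-link step (p674990–p676301) needs `|link_a 𝒰| = |link_b 𝒲|`. Here is the
general cut, with NO hypothesis on the families (not even lower): extend a `K`-state table by one state `q = last K` read by the row
coordinate `a` with entry `1` and by the column coordinate `b` with entry `1` (their other entries silenced), and by every other coordinate
with ARBITRARY shifts `γ`, `γ'`; weight `t` on `q`. Then the new full hidden sum is `P + t·Q` with
`P[i,j] = [a ∉ u i][b ∉ w j]·M[u i, w j]` (old sum) and `Q[i,j] = M^{γ,γ'}[(u i)∖a, (w j)∖b]` (old sum with base rows shifted by `γ`, `γ'`),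
so `det = t^{#{j : b ∈ w j}} · (det N + O(t))` where the TWO-STOREY MATRIX `N` takes column `j` from `Q` if `b ∈ w j` and from `P` otherwise
(`fullJoin_unequalCut_entry`, `fullJoinCube_unequalCut`). With `γ = γ' = 0` and lower families `N` is block-triangular — the equal-link step;
with generic shifts it is an honest square matrix whenever `|𝒰| = |𝒲|`, whatever the link sizes. Numerically (kit j320412/j320413) some cut
has `det N ≠ 0` for every lower pair at h = 4 and for 99.6 % at h = 5 (memo §14(b)).

WHAT THIS IS NOT: no pair is certified here; item 19717 stays OPEN; nothing on crux 14610 or VP ≠ VNP.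
-/

set_option linter.dupNamespace false

namespace Summit.ValiantsHypothesis.ValiantsHypothesis.Theorems.BarrierLever.HiddenStates

open Finset Matrix

noncomputable section

namespace FullJoin

variable {h K r : ℕ}

/-- The `x`-factor over a state set containing the new state `last K`: coordinate `a` contributes the factor `1`, every other
coordinate its old affine form with base shifted by `γ`. -/
theorem xFactor_transfer_last (tx : Option (Fin K) → Fin h → ℂ) (a : Fin h) (γ : Fin h → ℂ) (U : Finset (Fin h))
    (J₀ : Finset (Fin K)) :
    (∏ a' ∈ U, ((fun (o : Option (Fin (K + 1))) (x : Fin h) =>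
        (o.elim (if x = a then 0 else tx none x)
          (fun q => Fin.lastCases (if x = a then 1 else γ x) (fun q₀ => if x = a then 0 else tx (some q₀) x) q) : ℂ)) none a' +
        ∑ q ∈ insert (Fin.last K) (J₀.map Fin.castSuccEmb), (fun (o : Option (Fin (K + 1))) (x : Fin h) =>
          (o.elim (if x = a then 0 else tx none x)
            (fun q => Fin.lastCases (if x = a then 1 else γ x) (fun q₀ => if x = a then 0 else tx (some q₀) x) q) : ℂ))
            (some q) a')) =
      ∏ a' ∈ U.erase a, ((tx none a' + γ a') + ∑ q ∈ J₀, tx (some q) a') := by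
  classical
  have hlast : Fin.last K ∉ J₀.map Fin.castSuccEmb := by simp [Finset.mem_map]
  rw [← Finset.prod_erase (s := U) (a := a)]
  · refine Finset.prod_congr rfl fun a' ha' => ?_
    have hne : a' ≠ a := Finset.ne_of_mem_erase ha'
    rw [Finset.sum_insert hlast]
    simp only [Option.elim, if_neg hne, Finset.sum_map, Fin.castSuccEmb_apply, Fin.lastCases_castSucc, Fin.lastCases_last]
    ring
  · rw [Finset.sum_insert hlast]
    simp only [Option.elim, if_true, Finset.sum_map, Fin.castSuccEmb_apply, Fin.lastCases_castSucc, Fin.lastCases_last,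
      Finset.sum_const_zero]
    ring

/-- The `x`-factor over a state set avoiding the new state, for a set `U ∋ a`: it vanishes (coordinate `a` reads nothing). -/
theorem xFactor_transfer_zero (tx : Option (Fin K) → Fin h → ℂ) (a : Fin h) (γ : Fin h → ℂ) (U : Finset (Fin h)) (haU : a ∈ U)
    (J₀ : Finset (Fin K)) :
    (∏ a' ∈ U, ((fun (o : Option (Fin (K + 1))) (x : Fin h) =>
        (o.elim (if x = a then 0 else tx none x)
          (fun q => Fin.lastCases (if x = a then 1 else γ x) (fun q₀ => if x = a then 0 else tx (some q₀) x) q) : ℂ)) none a' +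
        ∑ q ∈ J₀.map Fin.castSuccEmb, (fun (o : Option (Fin (K + 1))) (x : Fin h) =>
          (o.elim (if x = a then 0 else tx none x)
            (fun q => Fin.lastCases (if x = a then 1 else γ x) (fun q₀ => if x = a then 0 else tx (some q₀) x) q) : ℂ))
            (some q) a')) = 0 := by
  classical
  refine Finset.prod_eq_zero haU ?_
  simp only [Option.elim, if_true, Finset.sum_map, Fin.castSuccEmb_apply, Fin.lastCases_castSucc, Finset.sum_const_zero, add_zero]

/-- **The entry identity of the unequal cut.** With the extended tables and weights `Fin.lastCases t lam`, the new full hidden sum at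
`(U, W)` equals `[a ∉ U][b ∉ W]·M[U,W] + t · M^{γ,γ'}[U∖a, W∖b]`. -/
theorem fullJoin_unequalCut_entry (tx ty : Option (Fin K) → Fin h → ℂ) (lam : Fin K → ℂ) (a b : Fin h) (γ γ' : Fin h → ℂ)
    (t : ℂ) (U W : Finset (Fin h)) :
    (∑ J : Finset (Fin (K + 1)), (∏ q ∈ J, (Fin.lastCases t lam q : ℂ)) *
        ((∏ a' ∈ U, ((fun (o : Option (Fin (K + 1))) (x : Fin h) =>
            (o.elim (if x = a then 0 else tx none x)
              (fun q => Fin.lastCases (if x = a then 1 else γ x) (fun q₀ => if x = a then 0 else tx (some q₀) x) q) : ℂ)) none a' +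
            ∑ q ∈ J, (fun (o : Option (Fin (K + 1))) (x : Fin h) =>
              (o.elim (if x = a then 0 else tx none x)
                (fun q => Fin.lastCases (if x = a then 1 else γ x) (fun q₀ => if x = a then 0 else tx (some q₀) x) q) : ℂ))
                (some q) a')) *
          ∏ c' ∈ W, ((fun (o : Option (Fin (K + 1))) (x : Fin h) =>
            (o.elim (if x = b then 0 else ty none x)
              (fun q => Fin.lastCases (if x = b then 1 else γ' x) (fun q₀ => if x = b then 0 else ty (some q₀) x) q) : ℂ)) none c' +
            ∑ q ∈ J, (fun (o : Option (Fin (K + 1))) (x : Fin h) =>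
              (o.elim (if x = b then 0 else ty none x)
                (fun q => Fin.lastCases (if x = b then 1 else γ' x) (fun q₀ => if x = b then 0 else ty (some q₀) x) q) : ℂ))
                (some q) c'))) =
      (if a ∉ U ∧ b ∉ W then ∑ J₀ : Finset (Fin K), (∏ q ∈ J₀, lam q) *
          ((∏ a' ∈ U, (tx none a' + ∑ q ∈ J₀, tx (some q) a')) * ∏ c' ∈ W, (ty none c' + ∑ q ∈ J₀, ty (some q) c')) else 0) +
        t * ∑ J₀ : Finset (Fin K), (∏ q ∈ J₀, lam q) *
          ((∏ a' ∈ U.erase a, ((tx none a' + γ a') + ∑ q ∈ J₀, tx (some q) a')) *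
            ∏ c' ∈ W.erase b, ((ty none c' + γ' c') + ∑ q ∈ J₀, ty (some q) c')) := by
  classical
  set S' : Finset (Fin (K + 1)) := (Finset.univ : Finset (Fin K)).map Fin.castSuccEmb with hS'
  have hlast : Fin.last K ∉ S' := by rw [hS']; simp [Finset.mem_map]
  have huniv : (Finset.univ : Finset (Finset (Fin (K + 1)))) = (insert (Fin.last K) S').powerset := by
    rw [← Finset.powerset_univ, Fin.univ_castSuccEmb, Finset.cons_eq_insert]
  rw [huniv, Finset.sum_powerset_insert hlast]
  -- the powerset of the image is the image of the powerset
  have hpow : S'.powerset = (Finset.univ : Finset (Fin K)).powerset.image (fun J₀ => J₀.map Fin.castSuccEmb) := by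
    rw [hS', Finset.map_eq_image, Finset.powerset_image]
    refine Finset.image_congr fun J₀ _ => ?_
    rw [Finset.map_eq_image]
  have hinj : ∀ J₀ ∈ (Finset.univ : Finset (Fin K)).powerset, ∀ J₁ ∈ (Finset.univ : Finset (Fin K)).powerset,
      J₀.map Fin.castSuccEmb = J₁.map Fin.castSuccEmb → J₀ = J₁ := fun J₀ _ J₁ _ hJ => Finset.map_injective Fin.castSuccEmb hJ
  congr 1
  · -- old part
    by_cases hab : a ∉ U ∧ b ∉ W
    · rw [if_pos hab, hS']
      exact sum_transfer tx ty lam a b (fun x => if x = a then 1 else γ x) (fun x => if x = b then 1 else γ' x) t U W hab.1 hab.2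
    · rw [if_neg hab, hpow, Finset.sum_image hinj]
      refine Finset.sum_eq_zero fun J₀ _ => ?_
      rw [not_and_or, not_not, not_not] at hab
      rcases hab with haU | hbW
      · rw [xFactor_transfer_zero tx a γ U haU J₀]; ring
      · rw [xFactor_transfer_zero ty b γ' W hbW J₀]; ring
  · -- new part
    rw [hpow, Finset.sum_image hinj, Finset.powerset_univ, Finset.mul_sum]
    refine Finset.sum_congr rfl fun J₀ _ => ?_
    have hlastJ : Fin.last K ∉ J₀.map Fin.castSuccEmb := by simp [Finset.mem_map]
    rw [Finset.prod_insert hlastJ, Fin.lastCases_last, Finset.prod_map, xFactor_transfer_last tx a γ U J₀,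
      xFactor_transfer_last ty b γ' W J₀]
    simp only [Fin.castSuccEmb_apply, Fin.lastCases_castSucc]
    ring

/-- A continuous function nonzero at `0` is nonzero at some `t ≠ 0` (in `ℂ`). -/
theorem exists_ne_zero_of_det (N Q : Matrix (Fin r) (Fin r) ℂ) (hN : N.det ≠ 0) : ∃ t : ℂ, t ≠ 0 ∧ (N + t • Q).det ≠ 0 := by
  have hcont : Continuous fun t : ℂ => (N + t • Q).det :=
    (continuous_const.add (continuous_id.smul continuous_const)).matrix_det
  have h0 : (fun t : ℂ => (N + t • Q).det) 0 ≠ 0 := by simpa using hN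
  have hev : ∀ᶠ t in nhdsWithin (0 : ℂ) {0}ᶜ, (N + t • Q).det ≠ 0 :=
    nhdsWithin_le_nhds (hcont.continuousAt.eventually_ne h0)
  have hev' : ∀ᶠ t in nhdsWithin (0 : ℂ) {0}ᶜ, t ≠ 0 := self_mem_nhdsWithin
  obtain ⟨t, ht, ht0⟩ := (hev.and hev').exists
  exact ⟨t, ht0, ht⟩

/-- **THE UNEQUAL-LINK CUT (node level).** If the two-storey matrix `N` (column `j` from `Q = M^{γ,γ'}[(u i)∖a, (w j)∖b]` when `b ∈ w j`,
from `P = [a ∉ u i]·M[u i, w j]` otherwise) is nonsingular for some `K`-state table and shifts `γ`, `γ'`, then FJ holds for `(u, w)` with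
`K + 1` states. No hypothesis on the families. -/
theorem fullJoinCube_unequalCut (u w : Fin r → Finset (Fin h)) (a b : Fin h) (tx ty : Option (Fin K) → Fin h → ℂ) (lam : Fin K → ℂ)
    (γ γ' : Fin h → ℂ)
    (hN : (Matrix.of fun i j : Fin r =>
        if b ∈ w j then ∑ J₀ : Finset (Fin K), (∏ q ∈ J₀, lam q) *
            ((∏ a' ∈ (u i).erase a, ((tx none a' + γ a') + ∑ q ∈ J₀, tx (some q) a')) *
              ∏ c' ∈ (w j).erase b, ((ty none c' + γ' c') + ∑ q ∈ J₀, ty (some q) c'))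
        else if a ∈ u i then 0 else ∑ J₀ : Finset (Fin K), (∏ q ∈ J₀, lam q) *
            ((∏ a' ∈ u i, (tx none a' + ∑ q ∈ J₀, tx (some q) a')) * ∏ c' ∈ w j, (ty none c' + ∑ q ∈ J₀, ty (some q) c'))).det ≠ 0) :
    ∃ (tx' ty' : Option (Fin (K + 1)) → Fin h → ℂ) (lam' : Fin (K + 1) → ℂ),
      (Matrix.of fun i j : Fin r => ∑ J : Finset (Fin (K + 1)), (∏ q ∈ J, lam' q) *
        ((∏ a' ∈ u i, (tx' none a' + ∑ q ∈ J, tx' (some q) a')) *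
          ∏ c ∈ w j, (ty' none c + ∑ q ∈ J, ty' (some q) c))).det ≠ 0 := by
  classical
  -- the matrices P, Q, N, Q̃
  set P : Matrix (Fin r) (Fin r) ℂ := Matrix.of fun i j : Fin r => if a ∉ u i ∧ b ∉ w j then
      ∑ J₀ : Finset (Fin K), (∏ q ∈ J₀, lam q) *
        ((∏ a' ∈ u i, (tx none a' + ∑ q ∈ J₀, tx (some q) a')) * ∏ c' ∈ w j, (ty none c' + ∑ q ∈ J₀, ty (some q) c')) else 0
    with hP
  set Q : Matrix (Fin r) (Fin r) ℂ := Matrix.of fun i j : Fin r => ∑ J₀ : Finset (Fin K), (∏ q ∈ J₀, lam q) *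
      ((∏ a' ∈ (u i).erase a, ((tx none a' + γ a') + ∑ q ∈ J₀, tx (some q) a')) *
        ∏ c' ∈ (w j).erase b, ((ty none c' + γ' c') + ∑ q ∈ J₀, ty (some q) c')) with hQ
  set N : Matrix (Fin r) (Fin r) ℂ := Matrix.of fun i j : Fin r => if b ∈ w j then Q i j else P i j with hNdef
  set Qt : Matrix (Fin r) (Fin r) ℂ := Matrix.of fun i j : Fin r => if b ∈ w j then 0 else Q i j with hQt
  have hN' : N.det ≠ 0 := by
    have hNN : N = (Matrix.of fun i j : Fin r =>
        if b ∈ w j then ∑ J₀ : Finset (Fin K), (∏ q ∈ J₀, lam q) *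
            ((∏ a' ∈ (u i).erase a, ((tx none a' + γ a') + ∑ q ∈ J₀, tx (some q) a')) *
              ∏ c' ∈ (w j).erase b, ((ty none c' + γ' c') + ∑ q ∈ J₀, ty (some q) c'))
        else if a ∈ u i then 0 else ∑ J₀ : Finset (Fin K), (∏ q ∈ J₀, lam q) *
            ((∏ a' ∈ u i, (tx none a' + ∑ q ∈ J₀, tx (some q) a')) * ∏ c' ∈ w j, (ty none c' + ∑ q ∈ J₀, ty (some q) c'))) := by
      ext i j
      simp only [hNdef, hP, hQ, Matrix.of_apply]
      by_cases hb : b ∈ w j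
      · simp [hb]
      · by_cases ha : a ∈ u i <;> simp [hb, ha]
    rw [hNN]; exact hN
  obtain ⟨t, ht0, ht⟩ := exists_ne_zero_of_det N Qt hN'
  -- the extended tables
  let tx' : Option (Fin (K + 1)) → Fin h → ℂ := fun o x =>
    o.elim (if x = a then 0 else tx none x)
      (fun q => Fin.lastCases (if x = a then 1 else γ x) (fun q₀ => if x = a then 0 else tx (some q₀) x) q)
  let ty' : Option (Fin (K + 1)) → Fin h → ℂ := fun o x =>
    o.elim (if x = b then 0 else ty none x)
      (fun q => Fin.lastCases (if x = b then 1 else γ' x) (fun q₀ => if x = b then 0 else ty (some q₀) x) q)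
  let lam' : Fin (K + 1) → ℂ := Fin.lastCases t lam
  refine ⟨tx', ty', lam', ?_⟩
  have hmat : (Matrix.of fun i j : Fin r => ∑ J : Finset (Fin (K + 1)), (∏ q ∈ J, lam' q) *
        ((∏ a' ∈ u i, (tx' none a' + ∑ q ∈ J, tx' (some q) a')) *
          ∏ c ∈ w j, (ty' none c + ∑ q ∈ J, ty' (some q) c))) = P + t • Q := by
    ext i j
    rw [Matrix.of_apply, Matrix.add_apply, Matrix.smul_apply, smul_eq_mul]
    exact fullJoin_unequalCut_entry tx ty lam a b γ γ' t (u i) (w j)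
  -- `P + t Q = (N + t Q̃) · D`
  have hfac : P + t • Q = (N + t • Qt) * Matrix.diagonal (fun j : Fin r => if b ∈ w j then t else 1) := by
    ext i j
    rw [Matrix.mul_diagonal, Matrix.add_apply, Matrix.smul_apply, Matrix.add_apply, Matrix.smul_apply, smul_eq_mul, smul_eq_mul]
    simp only [hNdef, hQt, Matrix.of_apply]
    by_cases hb : b ∈ w j
    · have hPz : P i j = 0 := by simp [hP, hb]
      rw [hPz]; simp [hb]; ring
    · simp [hb]
  have hD : (Matrix.diagonal (fun j : Fin r => if b ∈ w j then t else (1 : ℂ))).det ≠ 0 := by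
    rw [Matrix.det_diagonal]
    exact Finset.prod_ne_zero_iff.mpr fun j _ => by by_cases hb : b ∈ w j <;> simp [hb, ht0]
  rw [hmat, hfac, Matrix.det_mul]
  exact mul_ne_zero ht hD

end FullJoin

end

end Summit.ValiantsHypothesis.ValiantsHypothesis.Theorems.BarrierLever.HiddenStates
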